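import Literature.Computability.FineGrained.SplitAndListOV
import HarnessLib

/-!
# SETH ⇒ `k`-OV: the split-and-list instance of a CNF (the instance built on the word RAM)

The `k`-way split-and-list reduction (V. Vassilevska Williams, ICM 2018, §3, Thm. 3.1, after
R. Williams, TCS 348 (2005), §5.1) maps a CNF `φ` on `n` variables with `m` clauses and a number
`k` of groups to a `k`-OV instance: the variables are split into `k` groups of `g` consecutive
variables, list `l` has one vector for each of the `N = 2^g` assignments `a` of group `l`, and
coordinate `j` of that vector is `0` iff the partial assignment already satisfies clause `j`; an
orthogonal `k`-tuple is exactly a satisfying assignment. This file defines that instance in the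
closed Boolean form the word-RAM program of the reduction computes (the proof of the named fact
`sparseKSATInRAMTime_of_kOV_inTimeO` of `…FineGrained.KOVFromSETH`; everything in the namespace
`KOVRed` of that program), and proves it correct (the
position graph of the clique reduction, `…CliqueETHPositionGraph` / `…CliqueETHReductionProgram`,
is the model; reused from there: `getElem?_flatMap_const`, `foldr_max_one_le`,
`CliqueRed.lt_numVars_of_mem`, and from the two-list instance `…SplitAndListOV` the word lemmas
`length_encodeBoolVec`, `encodeBoolVec_getElem?`, `le_one_of_mem_encodeBoolVec`):

* `KOVRed.grpLen n k = ⌊n/k⌋ + 1` (so that `N = 2^{grpLen} ≥ 2` and every variable `v < n < k · grpLen`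
  lies in group `v / grpLen < k`); `satB φ g l a j` ("some literal of clause `j` on a variable of
  group `l` is made true by the assignment `a` of that group", the assignment being read off the
  bits of `a`), `vecB φ g l a j = [j < m] ∧ ¬ satB` (the vector bit; padding coordinates `j ≥ m`
  are `0`);
* `KOVRed.splitInstance φ k c : KOVInstance k` — `N = 2^g` vectors per list, dimension `d = c · g`
  (so `d = c ⌊log₂ N⌋`: the instance lies in `kOVWithDim k c`, `splitInstance_mem`), tables `vecB`;
* **`KOVRed.hasOrthogonalTuple_splitInstance_iff`**: for `k ≥ 1` and `m ≤ c g` the split instance has an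
  orthogonal `k`-tuple iff `φ` is satisfiable (so `(kOV k).Good` is `{[1]}`/`{[0]}` accordingly,
  `kOV_good_splitInstance`);
* the word-level layout of `(kOV k).encode (splitInstance φ k c) = N :: d :: ⟨bits⟩`
  (`kOV_encode_splitInstance_getElem?_entry`: word `2 + (l N + a) d + j` is the bit `(l, a, j)`),
  its length `2 + k N d` and input width `Nat.size (2 + k N d)` (`kOV_width_splitInstance`).

## References

* V. Vassilevska Williams, *On some fine-grained questions in algorithms and complexity*,
  Proc. ICM 2018, §3, Thm. 3.1 (proof) and §2 (input conventions of the word RAM).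
* R. Williams, *A new algorithm for optimal 2-constraint satisfaction and its implications*,
  Theoret. Comput. Sci. 348 (2005), §5.1 (Thm. 5.1; `k = 2`).
-/

namespace Literature.Computability.FineGrained

open Cryptography Cryptography.WordRAM Complexity

namespace KOVRed

/-! ### The split-and-list instance -/

/-- The group length of the split: `⌊n/k⌋ + 1` consecutive variables per group (at least one, so
that the lists are never empty and `k` groups cover all `n` variables). Compare the block length
`blockLen m k = ⌈m/k⌉` of the clique reduction (`…CliqueETHPositionGraph`), which may vanish; the
extra variable here at most doubles `N = 2^{grpLen}` (`splitInstance_n_real_le`). [folklore] -/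
def grpLen (n k : ℕ) : ℕ := n / k + 1

/-- `n < k · grpLen n k` for `k ≥ 1`: the `k` groups cover all variables. [folklore] -/
theorem lt_mul_grpLen (n : ℕ) {k : ℕ} (hk : 0 < k) : n < k * grpLen n k := by
  unfold grpLen
  rw [Nat.mul_add, Nat.mul_one]
  have h1 := Nat.div_add_mod n k
  have h2 := Nat.mod_lt n hk
  omega

/-- Every variable `v < n` lies in a group `v / grpLen n k < k` (for `k ≥ 1`). [folklore] -/
theorem div_grpLen_lt {n k v : ℕ} (hk : 0 < k) (hv : v < n) : v / grpLen n k < k := by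
  have hg : 0 < grpLen n k := Nat.succ_pos _
  rw [Nat.div_lt_iff_lt_mul hg]
  exact hv.trans (lt_mul_grpLen n hk)

section Instance

variable (φ : CNF ℕ) (g : ℕ)

/-- `satB φ g l a j`: clause `j` of `φ` is *already satisfied within group `l`* by the partial
assignment coded by `a` — some literal `(v, b)` of clause `j` has its variable in group `l`
(`v / g = l`) and receives the value `b` (bit `v % g` of `a`). Absent clauses are not satisfied.
(VVW ICM 2018, proof of Thm. 3.1: "`a_j(φ)[c] = 0` if the `c`th clause is satisfied by `φ`".)
[cite: VassilevskaWilliamsICM2018, §3 Thm. 3.1 (proof)] -/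
def satB (l a j : ℕ) : Bool :=
  match φ[j]? with
  | none => false
  | some cl => cl.any fun lit => decide (lit.1 / g = l) && (a.testBit (lit.1 % g) == lit.2)

/-- The vector bit: coordinate `j` of the vector of assignment `a` of group `l` is `1` iff clause
`j` exists and is not already satisfied within group `l` by `a` (padding coordinates `j ≥ m` are
`0`). [cite: VassilevskaWilliamsICM2018, §3 Thm. 3.1 (proof)] -/
def vecB (l a j : ℕ) : Bool :=
  decide (j < φ.length) && !satB φ g l a j

/-- `satB` on an existing clause. [folklore] -/
theorem satB_eq_true_iff {l a j : ℕ} (hj : j < φ.length) :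
    satB φ g l a j = true ↔ ∃ lit ∈ φ[j], lit.1 / g = l ∧ a.testBit (lit.1 % g) = lit.2 := by
  unfold satB
  rw [List.getElem?_eq_getElem hj]
  simp [List.any_eq_true]

/-- `vecB` past the last clause is `0`. [folklore] -/
theorem vecB_of_le {l a j : ℕ} (hj : φ.length ≤ j) : vecB φ g l a j = false := by
  simp [vecB, Nat.not_lt.2 hj]

/-- `vecB` on an existing clause is the negation of `satB`. [folklore] -/
theorem vecB_of_lt {l a j : ℕ} (hj : j < φ.length) : vecB φ g l a j = !satB φ g l a j := by
  simp [vecB, hj]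

end Instance

/-- **The split-and-list instance** of `φ` with `k` lists and dimension constant `c`: group length
`g = grpLen n k`, `N = 2^g` vectors per list (one per assignment of a group), dimension `d = c g`,
tables `vecB`. (VVW ICM 2018, proof of Thm. 3.1, with the padding of the remark following it.)
[cite: VassilevskaWilliamsICM2018, §3 Thm. 3.1 (proof)] -/
def splitInstance (φ : CNF ℕ) (k c : ℕ) : KOVInstance k where
  n := 2 ^ grpLen φ.numVars k
  d := c * grpLen φ.numVars k
  vecs l a j := vecB φ (grpLen φ.numVars k) l a j

/-- The number of vectors per list of the split instance is `N = 2^g`. [folklore] -/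
@[simp] theorem splitInstance_n (φ : CNF ℕ) (k c : ℕ) :
    (splitInstance φ k c).n = 2 ^ grpLen φ.numVars k := rfl

/-- The dimension of the split instance is `d = c g`. [folklore] -/
@[simp] theorem splitInstance_d (φ : CNF ℕ) (k c : ℕ) :
    (splitInstance φ k c).d = c * grpLen φ.numVars k := rfl

/-- The tables of the split instance are `vecB`. [folklore] -/
@[simp] theorem splitInstance_vecs (φ : CNF ℕ) (k c : ℕ) (l : Fin k) (a : Fin (splitInstance φ k c).n)
    (j : Fin (splitInstance φ k c).d) :
    (splitInstance φ k c).vecs l a j = vecB φ (grpLen φ.numVars k) l a j := rfl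

/-- **The split instance lies in the regime `d = c ⌊log₂ N⌋`** of `kOVWithDim k c`. [folklore] -/
theorem splitInstance_mem (φ : CNF ℕ) (k c : ℕ) :
    splitInstance φ k c ∈ {I : KOVInstance k | I.d = c * Nat.log 2 I.n} := by
  show c * grpLen φ.numVars k = c * Nat.log 2 (2 ^ grpLen φ.numVars k)
  rw [Nat.log_pow Nat.one_lt_two]

/-- `2 ≤ N`. [folklore] -/
theorem two_le_splitInstance_n (φ : CNF ℕ) (k c : ℕ) : 2 ≤ (splitInstance φ k c).n := by
  rw [splitInstance_n]
  calc 2 = 2 ^ 1 := rfl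
    _ ≤ 2 ^ grpLen φ.numVars k := Nat.pow_le_pow_right Nat.two_pos (Nat.succ_le_succ (Nat.zero_le _))

/-- `1 ≤ d` for `c ≥ 1`. [folklore] -/
theorem one_le_splitInstance_d (φ : CNF ℕ) (k : ℕ) {c : ℕ} (hc : 1 ≤ c) :
    1 ≤ (splitInstance φ k c).d := by
  rw [splitInstance_d]
  exact Nat.one_le_iff_ne_zero.2 (Nat.mul_ne_zero (by omega) (Nat.succ_ne_zero _))

/-! ### Correctness of the split instance -/

/-- **Correctness of the split-and-list instance** (VVW ICM 2018, proof of Thm. 3.1): for `k ≥ 1`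
lists and all `m ≤ c g` clauses fitting as coordinates, the split instance has an orthogonal
`k`-tuple iff `φ` is satisfiable. (→) read the assignment off the bits of the chosen vectors'
indices; every clause `j < m` is a coordinate, covered by some list `l`, i.e. already satisfied
within group `l`. (←) choose in list `l` the index coding the restriction of a satisfying
assignment to group `l`; a clause is satisfied through some literal, whose variable's group covers
that coordinate, and padding coordinates are `0` everywhere.
[cite: VassilevskaWilliamsICM2018, §3 Thm. 3.1 (proof)] -/
theorem hasOrthogonalTuple_splitInstance_iff {φ : CNF ℕ} {k c : ℕ} (hk : 1 ≤ k)
    (hm : φ.length ≤ c * grpLen φ.numVars k) :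
    (splitInstance φ k c).HasOrthogonalTuple ↔ φ.Satisfiable := by
  set g := grpLen φ.numVars k with hg
  have hg0 : 0 < g := Nat.succ_pos _
  constructor
  · rintro ⟨cs, hcs⟩
    -- the assignment read off the chosen indices
    let σ : ℕ → Bool := fun v =>
      if h : v / g < k then (cs ⟨v / g, h⟩).1.testBit (v % g) else false
    refine ⟨σ, (CNF.eval_eq_true_iff φ σ).2 fun cl hcl => ?_⟩
    obtain ⟨j, hj, rfl⟩ := List.getElem_of_mem hcl
    obtain ⟨l, hl⟩ := hcs ⟨j, lt_of_lt_of_le hj hm⟩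
    change vecB φ g l (cs l).1 j = false at hl
    rw [vecB_of_lt φ g hj, Bool.not_eq_false', satB_eq_true_iff φ g hj] at hl
    obtain ⟨lit, hlit, hgrp, hbit⟩ := hl
    unfold Clause.eval
    rw [List.any_eq_true]
    refine ⟨lit, hlit, ?_⟩
    have hlk : lit.1 / g < k := hgrp ▸ l.2
    have hσ : σ lit.1 = lit.2 := by
      simp only [σ, dif_pos hlk]
      have : (⟨lit.1 / g, hlk⟩ : Fin k) = l := Fin.ext hgrp
      rw [this, hbit]
    simp [Literal.eval, hσ]
  · rintro ⟨σ, hσ⟩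
    have hsat := (CNF.eval_eq_true_iff φ σ).1 hσ
    -- list `l` chooses the index coding `σ` on group `l` (core's `Nat.ofBits`)
    let code : Fin k → ℕ := fun l => Nat.ofBits fun i : Fin g => σ (l * g + i)
    have hcode : ∀ l : Fin k, code l < (splitInstance φ k c).n := fun l => by
      rw [splitInstance_n]; exact Nat.ofBits_lt_two_pow _
    refine ⟨fun l => ⟨code l, hcode l⟩, fun t => ?_⟩
    by_cases ht : (t : ℕ) < φ.length
    · -- an existing clause: satisfied through some literal, covered by that literal's group
      have hcl := hsat _ (List.getElem_mem ht)
      unfold Clause.eval at hcl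
      rw [List.any_eq_true] at hcl
      obtain ⟨lit, hlit, hval⟩ := hcl
      have hv : lit.1 < φ.numVars := CliqueRed.lt_numVars_of_mem (List.getElem_mem ht) hlit
      have hl : lit.1 / g < k := div_grpLen_lt hk hv
      refine ⟨⟨lit.1 / g, hl⟩, ?_⟩
      change vecB φ g (lit.1 / g) (code ⟨lit.1 / g, hl⟩) t = false
      rw [vecB_of_lt φ g ht, Bool.not_eq_false', satB_eq_true_iff φ g ht]
      refine ⟨lit, hlit, rfl, ?_⟩
      simp only [code, Nat.testBit_ofBits_lt _ _ (Nat.mod_lt _ hg0)]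
      rw [Nat.div_add_mod']
      simpa [Literal.eval] using hval
    · -- a padding coordinate: `0` in every list; use list `0`
      refine ⟨⟨0, hk⟩, ?_⟩
      change vecB φ g 0 (code ⟨0, hk⟩) t = false
      exact vecB_of_le φ g (Nat.not_lt.1 ht)

/-- For sparse formulas the clauses fit: `m ≤ c' n` and `c = c' k + 1` give `m ≤ c g`.
[folklore] -/
theorem length_le_mul_grpLen {φ : CNF ℕ} {k c' : ℕ} (hk : 0 < k) (hm : φ.length ≤ c' * φ.numVars) :
    φ.length ≤ (c' * k + 1) * grpLen φ.numVars k := by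
  set n := φ.numVars
  have h1 : n ≤ k * grpLen n k := (lt_mul_grpLen n hk).le
  calc φ.length ≤ c' * n := hm
    _ ≤ c' * (k * grpLen n k) := Nat.mul_le_mul_left _ h1
    _ = (c' * k) * grpLen n k := by ring
    _ ≤ (c' * k + 1) * grpLen n k := Nat.mul_le_mul_right _ (Nat.le_succ _)

/-! ### The `kOV k` encoding of the split instance -/

/-- The `kOV k` encoding: `N :: d ::` the `k` tables of `N` rows of `d` bits. [folklore] -/
theorem kOV_encode_eq {k : ℕ} (I : KOVInstance k) :
    (kOV k).encode I = I.n :: I.d :: (List.finRange k).flatMap fun l =>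
      (List.finRange I.n).flatMap fun i => encodeBoolVec (I.vecs l i) := rfl

/-- The length of a concatenation of blocks of a common length. [folklore] -/
theorem length_flatMap_of_forall {α : Type*} (f : α → List ℕ) {n : ℕ} :
    ∀ (l : List α), (∀ a ∈ l, (f a).length = n) → (l.flatMap f).length = l.length * n
  | [], _ => by simp
  | a :: l, h => by
    rw [List.flatMap_cons, List.length_append, h a (by simp),
      length_flatMap_of_forall f l (fun b hb => h b (by simp [hb])), List.length_cons]
    ring

/-- The length of one table (the rows of one list) is `N d`. [folklore] -/
theorem length_flatMap_rows {k : ℕ} (I : KOVInstance k) (l : Fin k) :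
    ((List.finRange I.n).flatMap fun i => encodeBoolVec (I.vecs l i)).length = I.n * I.d := by
  rw [length_flatMap_of_forall _ (List.finRange I.n) (fun i _ => length_encodeBoolVec _),
    List.length_finRange]

/-- **The length of the `kOV k` encoding** is `2 + k N d`. [folklore] -/
theorem length_kOV_encode {k : ℕ} (I : KOVInstance k) :
    ((kOV k).encode I).length = 2 + k * (I.n * I.d) := by
  rw [kOV_encode_eq, List.length_cons, List.length_cons,
    length_flatMap_of_forall _ (List.finRange k) (fun l _ => length_flatMap_rows I l),
    List.length_finRange]
  ring

/-- Word `0` of the encoding is `N`. [folklore] -/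
theorem kOV_encode_getElem?_zero {k : ℕ} (I : KOVInstance k) : ((kOV k).encode I)[0]? = some I.n :=
  rfl

/-- Word `1` of the encoding is `d`. [folklore] -/
theorem kOV_encode_getElem?_one {k : ℕ} (I : KOVInstance k) : ((kOV k).encode I)[1]? = some I.d :=
  rfl

/-- **Word `2 + (l N + a) d + j` of the encoding is the bit `vecs l a j`.** [folklore] -/
theorem kOV_encode_getElem?_entry {k : ℕ} (I : KOVInstance k) (l : Fin k) (a : Fin I.n)
    (j : Fin I.d) :
    ((kOV k).encode I)[2 + ((l : ℕ) * I.n + a) * I.d + j]? = some (I.vecs l a j).toNat := by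
  rw [kOV_encode_eq, show 2 + ((l : ℕ) * I.n + a) * I.d + j = ((l : ℕ) * (I.n * I.d) +
      ((a : ℕ) * I.d + j)) + 1 + 1 by ring, List.getElem?_cons_succ, List.getElem?_cons_succ]
  have hin : (a : ℕ) * I.d + j < I.n * I.d := by
    calc (a : ℕ) * I.d + j < a * I.d + I.d := Nat.add_lt_add_left j.2 _
      _ = (a + 1) * I.d := by ring
      _ ≤ I.n * I.d := Nat.mul_le_mul_right _ a.2
  rw [getElem?_flatMap_const _ (List.finRange k) (fun l' _ => length_flatMap_rows I l') l (by simp)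
      _ hin]
  simp only [List.getElem_finRange]
  rw [getElem?_flatMap_const _ (List.finRange I.n) (fun i _ => length_encodeBoolVec _) a (by simp)
      _ j.2]
  simp only [List.getElem_finRange]
  exact encodeBoolVec_getElem? _ _

/-- Every word of the encoding is at most `max (max N d) 1`. [folklore] -/
theorem le_of_mem_kOV_encode {k : ℕ} (I : KOVInstance k) {w : ℕ} (hw : w ∈ (kOV k).encode I) :
    w ≤ max (max I.n I.d) 1 := by
  rw [kOV_encode_eq] at hw
  simp only [List.mem_cons, List.mem_flatMap] at hw
  rcases hw with rfl | rfl | ⟨l, -, i, -, hw⟩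
  · exact le_max_of_le_left (le_max_left _ _)
  · exact le_max_of_le_left (le_max_right _ _)
  · exact (le_one_of_mem_encodeBoolVec _ hw).trans (le_max_right _ _)

/-- The `kOV k` encoding of the split instance, bit by bit. [folklore] -/
theorem kOV_encode_splitInstance_getElem?_entry (φ : CNF ℕ) (k c : ℕ) {l a j : ℕ} (hl : l < k)
    (ha : a < (splitInstance φ k c).n) (hj : j < (splitInstance φ k c).d) :
    ((kOV k).encode (splitInstance φ k c))[2 + (l * (splitInstance φ k c).n + a) *
      (splitInstance φ k c).d + j]? = some (vecB φ (grpLen φ.numVars k) l a j).toNat :=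
  kOV_encode_getElem?_entry (splitInstance φ k c) ⟨l, hl⟩ ⟨a, ha⟩ ⟨j, hj⟩

/-- **The length of the encoding of the split instance** is `2 + k N d`. [folklore] -/
theorem length_kOV_encode_splitInstance (φ : CNF ℕ) (k c : ℕ) :
    ((kOV k).encode (splitInstance φ k c)).length =
      2 + k * ((splitInstance φ k c).n * (splitInstance φ k c).d) :=
  length_kOV_encode _

/-- **The input width of the split instance** is `Nat.size (2 + k N d)` when `k ≥ 1` and `c ≥ 1`:
the length of the encoding dominates every word (`N, d ≤ k N d` as `N ≥ 2`, `d ≥ 1`; bits `≤ 1`).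
[folklore] -/
theorem inputWidth_kOV_encode_splitInstance (φ : CNF ℕ) {k c : ℕ} (hk : 1 ≤ k) (hc : 1 ≤ c) :
    inputWidth ((kOV k).encode (splitInstance φ k c)) =
      Nat.size (2 + k * ((splitInstance φ k c).n * (splitInstance φ k c).d)) := by
  set I := splitInstance φ k c
  have hN : 2 ≤ I.n := two_le_splitInstance_n φ k c
  have hd : 1 ≤ I.d := one_le_splitInstance_d φ k hc
  unfold inputWidth
  rw [length_kOV_encode, max_eq_left]
  refine foldr_max_one_le (by omega) fun v hv => (le_of_mem_kOV_encode I hv).trans ?_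
  have h1 : I.n ≤ k * (I.n * I.d) :=
    calc I.n ≤ I.n * I.d := Nat.le_mul_of_pos_right _ hd
      _ ≤ k * (I.n * I.d) := Nat.le_mul_of_pos_left _ hk
  have h2 : I.d ≤ k * (I.n * I.d) :=
    calc I.d ≤ I.n * I.d := Nat.le_mul_of_pos_left _ (by omega)
      _ ≤ k * (I.n * I.d) := Nat.le_mul_of_pos_left _ hk
  refine max_le (max_le ?_ ?_) ?_ <;> omega

/-- The width of the split instance as a `kOV k` instance. [folklore] -/
theorem kOV_width_splitInstance (φ : CNF ℕ) {k c : ℕ} (hk : 1 ≤ k) (hc : 1 ≤ c) :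
    (kOV k).width (splitInstance φ k c) =
      Nat.size (2 + k * ((splitInstance φ k c).n * (splitInstance φ k c).d)) :=
  inputWidth_kOV_encode_splitInstance φ hk hc

open scoped Classical in
/-- **The accepted output on the split instance** (`k ≥ 1`, `m ≤ c g`): `[1]` if `φ` is
satisfiable, `[0]` otherwise. [folklore] -/
theorem kOV_good_splitInstance {φ : CNF ℕ} {k c : ℕ} (hk : 1 ≤ k)
    (hm : φ.length ≤ c * grpLen φ.numVars k) :
    (kOV k).Good (splitInstance φ k c) = {[if φ.Satisfiable then 1 else 0]} := by
  by_cases h : φ.Satisfiable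
  · rw [if_pos h]
    exact FGProblem.ofPred_good_of_pos _ _ _ _ ((hasOrthogonalTuple_splitInstance_iff hk hm).2 h)
  · rw [if_neg h]
    exact FGProblem.ofPred_good_of_neg _ _ _ _
      (fun h' => h ((hasOrthogonalTuple_splitInstance_iff hk hm).1 h'))

/-- The size of the split instance as a `kOV k` instance is `N`. [folklore] -/
theorem kOV_size_splitInstance (φ : CNF ℕ) (k c : ℕ) :
    (kOV k).size (splitInstance φ k c) = (splitInstance φ k c).n := rfl

/-- The same data for the restricted problem `kOVWithDim k c` (encoding, size, width and accepted
outputs are inherited along `FGProblem.restrict`). [folklore] -/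
theorem kOVWithDim_splitInstance (φ : CNF ℕ) (k c : ℕ) :
    (kOVWithDim k c).encode ⟨splitInstance φ k c, splitInstance_mem φ k c⟩ =
        (kOV k).encode (splitInstance φ k c) ∧
      (kOVWithDim k c).size ⟨splitInstance φ k c, splitInstance_mem φ k c⟩ =
        (splitInstance φ k c).n ∧
      (kOVWithDim k c).width ⟨splitInstance φ k c, splitInstance_mem φ k c⟩ =
        (kOV k).width (splitInstance φ k c) ∧
      (kOVWithDim k c).Good ⟨splitInstance φ k c, splitInstance_mem φ k c⟩ =
        (kOV k).Good (splitInstance φ k c) :=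
  ⟨rfl, rfl, rfl, rfl⟩

/-! ### Size of the split instance for sparse formulas -/

/-- The group length in real terms: `g ≤ n / k + 1`. [folklore] -/
theorem grpLen_real_le (n k : ℕ) : (grpLen n k : ℝ) ≤ (n : ℝ) / k + 1 := by
  unfold grpLen
  push_cast
  gcongr
  exact Nat.cast_div_le

/-- **The number of vectors in real terms**: `N = 2^g ≤ 2 · 2^{n/k}`. [folklore] -/
theorem splitInstance_n_real_le (φ : CNF ℕ) (k c : ℕ) :
    ((splitInstance φ k c).n : ℝ) ≤ 2 * (2 : ℝ) ^ ((φ.numVars : ℝ) / k) := by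
  rw [splitInstance_n]
  push_cast
  have h := grpLen_real_le φ.numVars k
  calc (2 : ℝ) ^ (grpLen φ.numVars k : ℕ) = (2 : ℝ) ^ ((grpLen φ.numVars k : ℕ) : ℝ) := by
        rw [Real.rpow_natCast]
    _ ≤ (2 : ℝ) ^ ((φ.numVars : ℝ) / k + 1) := Real.rpow_le_rpow_of_exponent_le one_le_two h
    _ = 2 * (2 : ℝ) ^ ((φ.numVars : ℝ) / k) := by
        rw [Real.rpow_add (by norm_num), Real.rpow_one]; ring

end KOVRed

end Literature.Computability.FineGrained
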